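import Summits.AnomalousDissipation.AnomalousDissipation.Theorems.BaireTransferRobustLoudUpgradeLineLeaf
import Summits.AnomalousDissipation.AnomalousDissipation.Theorems.BaireTransferRobustLoudUpgradeStubSteadyWindow
import Literature.Analysis.FluidPDE.LongTimeAveragePeriodic
import Literature.Analysis.FunctionSpaces.TorusFourierCalculus
import Literature.Analysis.FunctionSpaces.TorusCalculusProofs
import Literature.Analysis.FunctionSpaces.TorusSpaceTime
import Literature.Analysis.FunctionSpaces.TorusClassicalNSUniqueness

/-!
# Stub `stub_steadyWindowLeaf` of the line `malkin-cone-group-orbits`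
# (crux stmt-AnomalousDissipation-1144, `BaireTransfer.RobustLoudUpgrade`; lead's reshape v4)

`persistSteadyLeaf S a E ε ⊆ interior (loud S a E ε)`: a classical steady state `u₀` of
`NS_ν(f_c)` of ANY spatial mean with STRICT budgets `∫‖u₀‖² < E`, `ν‖∇u₀‖₂² > ε` that persists
`H¹`-continuously in its conserved-mean leaf under small changes of the force at the same
viscosity (`SteadyPersistsInLeaf`) makes a whole ball around `c` loud: every nearby force
`f_{c'}` carries a steady classical state `u'` that is `H¹`-close to `u₀`; `t ↦ u'` is a
`1`-periodic classical solution (whatever its mean), and its budgets `∫‖u'‖²`, `ν‖∇u'‖₂²` stay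
within the strict slack of those of `u₀` by the Peter–Paul inequality
`‖a + b‖² ≤ (1+η)‖a‖² + (1+η⁻¹)‖b‖²` integrated over `T³`.  Hence `ball c r ⊆ loud`, so
`c ∈ interior loud`.  This is verbatim the argument of the landed stub `stub_steadyWindow`
(`Theorems/BaireTransferRobustLoudUpgradeStubSteadyWindow.lean`), which never used the mean
conditions; its elementary helpers (`norm_add_sq_le`, `integral_norm_sq_le`, `gradNormSq_le`,
`meanEnergy_const`, `meanDissipation_const`) are reused from that module.

References: Temam, *Navier–Stokes Equations* (1979) Ch. II §1 (steady states); the vocabulary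
modules `Theorems/BaireTransferRobustLoudUpgradeLine.lean`,
`Theorems/BaireTransferRobustLoudUpgradeLineLeaf.lean`; patterns from
`Cruxes/RobustLoudUpgrade/Disproof.lean` §6 (`cLam_mem_loud`).
-/

-- `Summit.<Summit>.<Problem>` is the tree's mandated summit-side namespace (CONVENTIONS §2); for this
-- single-conjunct summit the two coincide, so the duplicate is deliberate.
set_option linter.dupNamespace false

noncomputable section

open scoped BigOperators Topology
open Filter Set Function TopologicalSpace MeasureTheory

namespace Summit.AnomalousDissipation.AnomalousDissipation.Theorems.RobustLoudUpgrade.SteadyWindowLeaf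

open Literature.Analysis.FunctionSpaces Literature.Analysis.FunctionSpaces.Torus
open Literature.Analysis.FluidPDE
open Summit.AnomalousDissipation.AnomalousDissipation.Theses.BaireTransfer
open Summit.AnomalousDissipation.AnomalousDissipation.Theorems.RobustLoudUpgrade.SteadyWindow

/-! ## The stub -/

/-- **Steady window in the leaf** (registered stub `stub_steadyWindowLeaf` of the line
`malkin-cone-group-orbits`, reshape v4): a leaf-persistent loud steady witness of any mean with
strict budgets makes a neighbourhood of its force loud,
`persistSteadyLeaf S a E ε ⊆ interior (loud S a E ε)`.  Proof: pick `η > 0` inside the strict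
slack (`(1+η)∫‖u₀‖² < E`, `(1+η)ε < ν‖∇u₀‖₂²`), then `δ > 0` absorbing an `H¹`-perturbation of
squared size `δ`; `SteadyPersistsInLeaf` gives a ball of forces whose steady states `u'` satisfy
`h1DistSq u' u₀ < δ` (the conserved mean is not needed), and each `t ↦ u'` is a `1`-periodic
classical loud witness at the same `ν`. [folklore] -/
theorem stub_steadyWindowLeaf : ∀ (S : Finset (Fin 3 → ℤ)) (a E ε : ℝ), persistSteadyLeaf S a E ε ⊆ interior (loud S a E ε) := by
  intro S a E ε c hc
  obtain ⟨ν, hν, hνa, u₀, p₀, hst, hE, hε, hpers⟩ := hc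
  have hsm₀ : IsSmooth u₀ := hst.smooth_velocity.isSmooth_slice (Set.mem_univ (0 : ℝ))
  -- the budgets of `u₀`, as integrals over `T³`
  set A₀ : ℝ := ∫ x, ‖u₀ x‖ ^ 2 with hA₀
  set G₀ : ℝ := gradNormSq u₀ with hG₀
  have hA : A₀ < E := by rwa [meanEnergy_const] at hE
  have hG : ε < ν * G₀ := by rwa [meanDissipation_const ν hsm₀] at hε
  -- slack: `η > 0` with `(1+η)A₀ < E`, `(1+η)ε < νG₀`
  obtain ⟨η, ⟨hηE, hηε⟩, hη0⟩ :
      ∃ η : ℝ, ((1 + η) * A₀ < E ∧ (1 + η) * ε < ν * G₀) ∧ 0 < η := by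
    have h1 : ∀ᶠ η : ℝ in 𝓝 0, (1 + η) * A₀ < E :=
      Filter.Tendsto.eventually_lt_const (v := (1 + 0) * A₀) (by simpa using hA)
        (((continuous_const.add continuous_id).mul continuous_const).tendsto' _ _ rfl)
    have h2 : ∀ᶠ η : ℝ in 𝓝 0, (1 + η) * ε < ν * G₀ :=
      Filter.Tendsto.eventually_lt_const (v := (1 + 0) * ε) (by simpa using hG)
        (((continuous_const.add continuous_id).mul continuous_const).tendsto' _ _ rfl)
    exact (((h1.and h2).filter_mono nhdsWithin_le_nhds).and
      (self_mem_nhdsWithin : Set.Ioi (0 : ℝ) ∈ 𝓝[>] (0 : ℝ))).exists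
  -- then `δ > 0` absorbing the `H¹`-perturbation
  obtain ⟨δ, ⟨hδE, hδε⟩, hδ0⟩ : ∃ δ : ℝ, ((1 + η) * A₀ + (1 + η⁻¹) * δ < E ∧
      (1 + η) * ε + ν * ((1 + η⁻¹) * δ) < ν * G₀) ∧ 0 < δ := by
    have h1 : ∀ᶠ δ : ℝ in 𝓝 0, (1 + η) * A₀ + (1 + η⁻¹) * δ < E :=
      Filter.Tendsto.eventually_lt_const (v := (1 + η) * A₀ + (1 + η⁻¹) * 0) (by simpa using hηE)
        ((continuous_const.add (continuous_const.mul continuous_id)).tendsto' _ _ rfl)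
    have h2 : ∀ᶠ δ : ℝ in 𝓝 0, (1 + η) * ε + ν * ((1 + η⁻¹) * δ) < ν * G₀ :=
      Filter.Tendsto.eventually_lt_const (v := (1 + η) * ε + ν * ((1 + η⁻¹) * 0))
        (by simpa using hηε)
        ((continuous_const.add
          (continuous_const.mul (continuous_const.mul continuous_id))).tendsto' _ _ rfl)
    exact (((h1.and h2).filter_mono nhdsWithin_le_nhds).and
      (self_mem_nhdsWithin : Set.Ioi (0 : ℝ) ∈ 𝓝[>] (0 : ℝ))).exists
  -- persistence in the leaf gives a ball of forces with `H¹`-close steady states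
  obtain ⟨r, hr, hball⟩ := hpers δ hδ0
  have hsub : Metric.ball c r ⊆ loud S a E ε := by
    intro c' hc'
    -- the conserved mean `∫ u' = ∫ u₀` is not needed: discard it
    obtain ⟨u', p', hst', -, hdist⟩ := hball c' (Metric.mem_ball.1 hc')
    have hsm' : IsSmooth u' := hst'.smooth_velocity.isSmooth_slice (Set.mem_univ (0 : ℝ))
    -- split the squared `H¹` distance into its two nonnegative parts
    have hL2 : 0 ≤ ∫ x, ‖u' x - u₀ x‖ ^ 2 := integral_nonneg fun _ => sq_nonneg _
    have hH1 : 0 ≤ gradNormSq (fun x => u' x - u₀ x) := gradNormSq_nonneg _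
    have hdist' : (∫ x, ‖u' x - u₀ x‖ ^ 2) + gradNormSq (fun x => u' x - u₀ x) < δ := hdist
    have hdL : ∫ x, ‖u' x - u₀ x‖ ^ 2 ≤ δ := by linarith
    have hdG : gradNormSq (fun x => u' x - u₀ x) ≤ δ := by linarith
    have hη1 : 0 ≤ 1 + η⁻¹ := by positivity
    -- energy budget `∫‖u'‖² ≤ E`
    have hEn : meanEnergy (fun _ : ℝ => u') ≤ E := by
      rw [meanEnergy_const]
      have h := integral_norm_sq_le hsm₀.continuous hsm'.continuous hη0
      have : (1 + η⁻¹) * ∫ x, ‖u' x - u₀ x‖ ^ 2 ≤ (1 + η⁻¹) * δ :=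
        mul_le_mul_of_nonneg_left hdL hη1
      linarith
    -- dissipation budget `ε ≤ ν‖∇u'‖₂²`
    have hDi : ε ≤ meanDissipation ν (fun _ : ℝ => u') := by
      rw [meanDissipation_const ν hsm']
      have h := gradNormSq_le hsm₀ hsm' hη0
      have h1 : (1 + η⁻¹) * gradNormSq (fun x => u' x - u₀ x) ≤ (1 + η⁻¹) * δ :=
        mul_le_mul_of_nonneg_left hdG hη1
      have h2 : ν * G₀ ≤ ν * ((1 + η) * gradNormSq u' + (1 + η⁻¹) * δ) :=
        mul_le_mul_of_nonneg_left (by linarith) hν.le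
      have h3 : (1 + η) * ε < (1 + η) * (ν * gradNormSq u') := by nlinarith
      exact (lt_of_mul_lt_mul_left h3 (by linarith)).le
    -- pattern from Cruxes/RobustLoudUpgrade/Disproof.lean §6 `cLam_mem_loud`
    exact ⟨ν, hν, hνa, 1, fun _ => u', fun _ => p', one_pos, hst', fun _ => rfl, hEn, hDi⟩
  exact interior_mono hsub (by rwa [Metric.isOpen_ball.interior_eq, Metric.mem_ball, dist_self])

end Summit.AnomalousDissipation.AnomalousDissipation.Theorems.RobustLoudUpgrade.SteadyWindowLeaf

end
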